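import Summits.QuantumFields.BalabanUV.Beta.EriceRemainderEnclosureHistoryAutonomyComparisonNonlinearSplit
import Summits.QuantumFields.BalabanUV.Beta.EriceRemainderEnclosureHistoryAutonomyComparisonNonlinearRelativeSize

/-!
# EriceRemainderEnclosureHistoryAutonomyComparisonNonlinearSplitLevel — (E125) **ONE STATEMENT FOR THE COLUMN: COMPARISON FOR EVERY SPLIT EXCESS `E = E₁ + E₂` (SMOOTH +
# ROUGH) WHOSE COMBINED SIZE `ME₁·h_m∕2 + E₂(S h_m)` IS AT MOST A TENTH OF THE LEVEL PER LOADED AGE ALONG THE BASE ORBIT.**  `B u = β₀ + Σ_{k<K} L_k·u_k` (`β₀ > 0`,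
# `L ≥ 0`, `L_0 = 0`; profile, range, sizes, loads ARBITRARY); functionals `B ≤ B₁ ≤ B′` on the box, `B₁ − B` isotone of modulus `ME₁` (any size), `B′ − B₁` isotone (any
# steepness, any size); `B′` with a modulus.  CONDITION, along the base solution `h` from the pin, at every depth `m ≥ k+1` of every loaded age `2 ≤ k < K`:
#     **`(ME₁·h_m∕2 + (B′ − B₁)(h_m, h_{m+1}, …))·(k−1) ≤ (1∕h_m²)∕10`.**
# Then (**`le_of_split_excess_level`**, family-free) ANY box solutions `h`, `h′` of `B`, `B′` from one pin satisfy `h′ ≤ h` at every scale.  This single statement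
# CONTAINS every comparison class of the column proved so far over an affine base with `L_0 = 0`: (E119d) small modulus (`E₂ = 0`, `ME·γ ≤ β₀∕5`, since `h_m ≤ γ`,
# `1∕h_m² ≥ m·β₀`), (E121e) small size (`E₁ = 0`, `E ≤ β₀∕10`), (E121f) size∕pin and UV (`1∕h_m² ≥ 1∕p²`), (E123b) smooth + small (`5ME₁γ + 10E₂ ≤ β₀`), (E124) relative size
# (`E₁ = 0`) — and is new where the rough part exceeds `β₀∕10` on a heavy tower whose level is built by the memory, or where the smooth part's modulus is large but the
# pins are deep (`h_m` small).  Assembled from the generic pieces: defect (E123a) `conf_incr_ge_split` (`θ_k = F + ME₁h³∕2 + e₂h² = F + (ME₁h∕2 + e₂)·h²`), price (E124)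
# `defect_level_le` at the relative size `(ME₁h_m∕2 + e₂(m))·(k−1) ≤ a_m∕10` (the perturbed `e₂(m) = (B′−B₁)(S′h_m) ≤ (B′−B₁)(S h_m)` by the comparison of configuration `m`),
# step (E121d) `gauge_step_of_defect`, base = the light deep region ((E49j)(1), (E120b) `base_gauge_light`, (E121b) `var_base`) as in (E121e)∕(E124) — NOT the
# generic base (E122a), whose price is in `β₀`.  (**`gauge_step_split_level`**, **`steps_nonneg_gauge_split_level`**, **`effective_le_split_level`**.)
#
# NUMERICAL CONTEXT (gen 100, renormalised solver + the linearised renewal equation `X(s) = e(s) − Σ_r w_r(s)·a′(s+k_r)·∫_s^{s+k_r} X∕a′`, kit j344145∕j344151 and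
# local runs): on towers with kernel first moment `T₀` up to 4.6 the infimum of `X∕E(S′y)` is the LINEAR response (exact, no cancellation: 0.135 at `T₀ = 2.4`, 0.023 at
# `T₀ = 4.6`), the nonlinear `X∕η` is monotone increasing in the amplitude for every shape tested, and `drop(η)` is concave in `η`.  What remains open after this file is
# exactly the amplitude range between the relative-size tenth and saturation; evidence, not proof.

Cell `pub-balaban`, β-function sub-cell, BINDER row D4 «RemainderConst leaves for Bałaban's split» (`HOME/BINDER-OWNERS.md`; owner lineage `b2b-balaban-beta-an4`;
this file by co-owner #2 lineage `b2b-balaban-beta-d4-p2`, generation 100), β-FLOW TEAM duty (1), FREEZE (0) honoured (def-free; imports (E123b), (E124); uses (E118a)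
`affine_facts`, (E119b) `excess_facts` ∕ `cmp_of_steps_nonneg` ∕ `excess_orbit_antitone`, (E120b) `base_gauge_light`, (E121b) `exists_base_depth_var` ∕ `var_base`, (E121d)
`gauge_step_of_defect`, (E123a) `conf_incr_ge_split`, (E123b) `split_facts` ∕ `split_orbit_antitone`, (E124) `defect_level_le`, (E49j) `effective_le_of_small_pin`, (E49k)
`family_le_of_orbit`, (E39) `exists_memFlow_zm`, (E43b) `memFlow_unique_of_monotone_zm`, (E48a) `family_mem` ∕ `family_zero` ∕ `family_tail_eq` BY NAME; §2–§3 are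
(E124)'s proofs re-run — nothing else restated).

HONEST FRAMING (page 1, verbatim and binding).  *"Discharging BetaPertH makes Bałaban's UV stability UNCONDITIONAL — a real constructive-QFT result; it is
NOT the continuum limit and NOT the Clay problem."*  THIS FILE DISCHARGES NOTHING OF THE KIND.  Elementary real analysis about ABSTRACT functionals on a box
]0,γ]^ℕ with displayed floors, moduli, profiles and signs — hypotheses of a census, not facts; the form, signs, ages and moments of Bałaban's (1.22) limit
functional are NOT PRINTED ([I] p. 298; GAPS G-t4-U2-1∕-2) and NOT asserted.  Row D4 class UNCHANGED (critical-path width 0; instance 0∕1; D4 DISCHARGE NO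
DATE).  HONEST DEPENDENCY: continuum YM on T⁴ ⇐ BetaPertH ∧ nine spine estimates (0/9 proved); BetaPertH ⇐ (D1) ∧ (D4) ∧ CAP+tail; G-an2-4 gates asym, D1
and NE2/3/4.  NOT CLAIMED: combined sizes above a tenth of the level per loaded age, Markov weight `L_0 > 0`, anything printed — NOT B12 Thm 2, NOT BetaPertH, NOT
continuum, NOT Clay.

WHAT IS PROVED ([folklore]; 0 `def`, 0 sorry).  §1 **`gauge_step_split_level`**.  §2 **`steps_nonneg_gauge_split_level`**.  §3 **`effective_le_split_level`**,
**`le_of_split_excess_level`**.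
-/

noncomputable section
open Finset Set

namespace Summit.QuantumFields.BalabanUV.Beta.EriceRemainderEnclosureHistoryAutonomyComparisonNonlinearSplitLevel

open Literature.MathematicalPhysics.QuantumFieldTheory.Balaban1983to89
open Literature.MathematicalPhysics.QuantumFieldTheory.Balaban1983to89.T4BetaStationary
open Literature.MathematicalPhysics.QuantumFieldTheory.Balaban1983to89.T4BetaFlowWellPosed
open Summit.QuantumFields.BalabanUV.Beta.EriceRemainderEnclosureHistoryAutonomyOrder (family_mem family_zero family_tail_eq le_of_pin_le strictAnti_of_memFlow)
open Summit.QuantumFields.BalabanUV.Beta.EriceRemainderEnclosureHistoryAutonomyComparisonExcess (effective_le_of_small_pin)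
open Summit.QuantumFields.BalabanUV.Beta.EriceRemainderEnclosureHistoryAutonomyComparisonIsotoneExcess (family_le_of_orbit)
open Summit.QuantumFields.BalabanUV.Beta.EriceRemainderEnclosureHistoryAutonomyExistence (exists_memFlow_zm)
open Summit.QuantumFields.BalabanUV.Beta.EriceRemainderEnclosureHistoryAutonomyMonotoneGeneral (memFlow_unique_of_monotone_zm)
open Summit.QuantumFields.BalabanUV.Beta.EriceRemainderEnclosureHistoryAutonomyComparisonNonlinearRowPrep (affine_facts)
open Summit.QuantumFields.BalabanUV.Beta.EriceRemainderEnclosureHistoryAutonomyComparisonNonlinearModulusPrep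
  (excess_facts cmp_of_steps_nonneg excess_orbit_antitone)
open Summit.QuantumFields.BalabanUV.Beta.EriceRemainderEnclosureHistoryAutonomyComparisonNonlinearLightBase (base_gauge_light)
open Summit.QuantumFields.BalabanUV.Beta.EriceRemainderEnclosureHistoryAutonomyComparisonNonlinearVariationBase (exists_base_depth_var var_base)
open Summit.QuantumFields.BalabanUV.Beta.EriceRemainderEnclosureHistoryAutonomyComparisonNonlinearGaugeDefect (gauge_step_of_defect)
open Summit.QuantumFields.BalabanUV.Beta.EriceRemainderEnclosureHistoryAutonomyComparisonNonlinearSplitPrep (conf_incr_ge_split)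
open Summit.QuantumFields.BalabanUV.Beta.EriceRemainderEnclosureHistoryAutonomyComparisonNonlinearSplit (split_facts split_orbit_antitone)
open Summit.QuantumFields.BalabanUV.Beta.EriceRemainderEnclosureHistoryAutonomyComparisonNonlinearRelativeSize (defect_level_le)

variable {B B₁ B' : (ℕ → ℝ) → ℝ} {γ β₀ M' ME₁ : ℝ} {L : ℕ → ℝ} {K : ℕ} {S S' : ℝ → ℕ → ℝ}

/-! ## §1 The step -/

set_option maxHeartbeats 800000 in
/-- **THE STEP OF THE ROW INDUCTION FOR A SPLIT EXCESS UNDER THE RELATIVE-SIZE CONDITION.**  Along the base orbit `h = S y` let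
`(ME₁·h_m∕2 + (B′−B₁)(S h_m))·(k−1) ≤ a_m∕10` for `2 ≤ k < K`, `m ≥ k+1`.  If `X_m ≥ 0` and `G_{m+1} ≤ G_m` for `m ≥ n+1`, and the variation bound for the total excess
holds for `m ≥ n+2`, then `G_{n+1} + (e_n − e_{n+1})·h_n² ≤ G_n` ((E121d) `gauge_step_of_defect` with (E123a) `conf_incr_ge_split`, priced by (E124) `defect_level_le`
at the relative size `ME₁h_m∕2 + e₂(m)`, `e₂(m) = (B′−B₁)(S′h_m) ≤ (B′−B₁)(S h_m)` by the comparison of configuration `m`). [folklore] -/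
theorem gauge_step_split_level (hBaff : ∀ u, SeqBox γ u → B u = β₀ + ∑ k ∈ range K, L k * u k) (hL : ∀ k, 0 ≤ L k) (hL0 : L 0 = 0) (hβ : 0 < β₀)
    (hB' : ∀ u u' : ℕ → ℝ, SeqBox γ u → SeqBox γ u' → ∀ D : ℝ, (∀ j, |u j - u' j| ≤ D) → |B' u - B' u'| ≤ M' * D) (hM' : 0 ≤ M')
    (hexc1 : ∀ u, SeqBox γ u → B u ≤ B₁ u) (hexc2 : ∀ u, SeqBox γ u → B₁ u ≤ B' u)
    (hDmono1 : ∀ u v : ℕ → ℝ, SeqBox γ u → SeqBox γ v → (∀ j, u j ≤ v j) → B₁ u - B u ≤ B₁ v - B v)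
    (hDmono2 : ∀ u v : ℕ → ℝ, SeqBox γ u → SeqBox γ v → (∀ j, u j ≤ v j) → B' u - B₁ u ≤ B' v - B₁ v)
    (hEmod1 : ∀ u u' : ℕ → ℝ, SeqBox γ u → SeqBox γ u' → (∀ j, u' j ≤ u j) → ∀ D : ℝ, 0 ≤ D → (∀ j, u j - u' j ≤ D) →
      (B₁ u - B u) - (B₁ u' - B u') ≤ ME₁ * D) (hME1 : 0 ≤ ME₁)
    (hS : ∀ p, 0 < p → p ≤ γ → SeqBox γ (S p) ∧ MemFlow B p (S p))
    (huniq : ∀ p, 0 < p → p ≤ γ → ∀ u u' : ℕ → ℝ, SeqBox γ u → SeqBox γ u' → MemFlow B p u → MemFlow B p u' → u = u')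
    (hS' : ∀ p, 0 < p → p ≤ γ → SeqBox γ (S' p) ∧ MemFlow B' p (S' p))
    (huniq' : ∀ p, 0 < p → p ≤ γ → ∀ u u' : ℕ → ℝ, SeqBox γ u → SeqBox γ u' → MemFlow B' p u → MemFlow B' p u' → u = u')
    {y : ℝ} (hy : 0 < y) (hyγ : y ≤ γ)
    (hElev : ∀ m k, 2 ≤ k → k < K → k + 1 ≤ m →
      (ME₁ * S y m / 2 + (B' (S (S y m)) - B₁ (S (S y m)))) * ((k : ℝ) - 1) ≤ 1 / S y m ^ 2 / 10) (n : ℕ)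
    (hX : ∀ m, n + 1 ≤ m → 0 ≤ B' (S' (S y m)) - B (S (S y m)))
    (hg : ∀ m, n + 1 ≤ m → (B' (S' (S y (m + 1))) - B (S (S y (m + 1)))) * S y (m + 1) ^ 2 ≤ (B' (S' (S y m)) - B (S (S y m))) * S y m ^ 2)
    (hV : ∀ m, n + 2 ≤ m → ∀ J, ∑ j ∈ range J, S y (m + j) ^ 2
        * ((B' (S' (S y (m + j))) - B (S' (S y (m + j)))) - (B' (S' (S y (m + j + 1))) - B (S' (S y (m + j + 1)))))
        ≤ (B' (S' (S y m)) - B (S (S y m))) * S y m ^ 2) :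
    (B' (S' (S y (n + 1))) - B (S (S y (n + 1)))) * S y (n + 1) ^ 2
        + ((B' (S' (S y n)) - B (S' (S y n))) - (B' (S' (S y (n + 1))) - B (S' (S y (n + 1))))) * S y n ^ 2
      ≤ (B' (S' (S y n)) - B (S (S y n))) * S y n ^ 2 := by
  obtain ⟨hexc, hDmono⟩ := split_facts (γ := γ) hexc1 hexc2 hDmono1 hDmono2
  obtain ⟨hmono', hlo'⟩ := excess_facts hBaff hL hβ hexc hDmono
  obtain ⟨hmono, hlo, _, _⟩ := affine_facts hBaff hL hβ
  have hh := (hS y hy hyγ).1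
  have hf := (hS y hy hyγ).2
  have hpos : ∀ j, 0 < S y j := fun j => (hh j).1
  have hcmp := cmp_of_steps_nonneg hBaff hL hβ hB' hM' hexc hDmono hS huniq hS' huniq' hy hyγ n hX
  have htail : ∀ m i, S (S y m) i = S y (m + i) := fun m i => (congrFun (family_tail_eq hS huniq hy hyγ m) i).symm
  set e : ℕ → ℝ := fun i => B' (S' (S y i)) - B₁ (S' (S y i)) with he_def
  have he0 : ∀ i, 0 ≤ e i := fun i => by simp only [he_def]; linarith [hexc2 _ (hS' _ (family_mem hS hy hyγ i).1 (family_mem hS hy hyγ i).2).1]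
  -- the variation bound for e₂ from the one for the total excess (Δe₁ ≥ 0 along the orbit)
  have hV2 : ∀ m, n + 2 ≤ m → ∀ J, ∑ j ∈ range J, S y (m + j) ^ 2 * (e (m + j) - e (m + j + 1)) ≤ (B' (S' (S y m)) - B (S (S y m))) * S y m ^ 2 := by
    intro m hm J
    refine le_trans (sum_le_sum fun j _ => ?_) (hV m hm J)
    have h1 := split_orbit_antitone hBaff hL hβ hB' hM' hexc1 hexc2 hDmono1 hDmono2 hS hS' huniq' hy hyγ (m + j)
    simp only [he_def]
    exact mul_le_mul_of_nonneg_left (by linarith) (sq_nonneg _)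
  -- the defect data
  set ξ : ℕ → ℝ := fun k => ME₁ * S y (n + k + 1) ^ 3 / 2 + e (n + k + 1) * S y (n + k + 1) ^ 2 with hξ_def
  set θ : ℕ → ℝ := fun k => ∑ q ∈ Ico 1 K, L q * S y (n + k + 1 + q) ^ 3 / 2 + ξ k with hθ_def
  have hθ0 : ∀ k, 0 ≤ θ k := fun k => by
    have h1 : 0 ≤ ∑ q ∈ Ico 1 K, L q * S y (n + k + 1 + q) ^ 3 / 2 :=
      sum_nonneg fun q _ => by have := hL q; have := hpos (n + k + 1 + q); positivity
    have h2 : 0 ≤ ξ k := by have := he0 (n + k + 1); have := hpos (n + k + 1); positivity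
    simp only [hθ_def]; linarith
  have hdef : ∀ j, j + 1 < K → (1 / S' (S y (n + 1)) j ^ 2 - 1 / S y (n + 1 + j) ^ 2)
      - (1 / S' (S y (n + 1)) (j + 1) ^ 2 - 1 / S y (n + 1 + j + 1) ^ 2)
      ≤ θ (j + 1) * (1 / S' (S y (n + 1)) j ^ 2 - 1 / S y (n + 1 + j) ^ 2) := by
    intro j _
    have h := conf_incr_ge_split hBaff hL hL0 hβ hB' hM' hexc1 hexc2 hDmono1 hDmono2 hEmod1 hME1 hS huniq hS' huniq' hy hyγ (n + 1) j
      (hcmp (n + 1) (by omega)) (hcmp (n + 1 + 1 + j) (by omega)) (hV2 (n + 1 + 1 + j) (by omega))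
    rw [show n + 1 + 1 + j = n + (j + 1) + 1 by ring] at h
    have e3 : ∑ q ∈ Ico 1 K, L q * S y (n + (j + 1) + 1 + q) ^ 3 / 2 + ME₁ * S y (n + (j + 1) + 1) ^ 3 / 2
        + e (n + (j + 1) + 1) * S y (n + (j + 1) + 1) ^ 2 = θ (j + 1) := by simp only [hθ_def, hξ_def, he_def]; ring
    rw [e3] at h
    exact h
  have hθle : ∀ k, 2 ≤ k → k < K → θ k ≤ ∑ q ∈ Ico 1 K, L q * S y (n + k + 1 + q) ^ 3 / 2 + ξ k := fun k _ _ => le_rfl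
  have hprice : ∀ k, 2 ≤ k → k < K → ∀ W : ℝ, 0 ≤ W →
      W ≤ (B' (S' (S y (n + 1))) - B (S (S y (n + 1)))) * S y (n + 1) ^ 2 * ∑ l ∈ Ico 1 k, 1 / S y (n + 1 + l) ^ 2 →
      L k * S y (n + 1 + k) ^ 3 / 2 * ξ k * W ≤ 1 / 20 * (L k * S y (n + 1 + k) * S y (n + 1) ^ 2 * (B' (S' (S y (n + 1))) - B (S (S y (n + 1))))) := by
    intro k hk2 hkK W _ hW
    have hk' : 0 ≤ (k : ℝ) - 1 := by have : (2 : ℝ) ≤ k := by exact_mod_cast hk2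
                                     linarith
    have hx := hpos (n + k + 1)
    -- the rough part at the perturbed configuration n+k+1 is below the one at the base configuration there
    have hqm := family_mem hS hy hyγ (n + k + 1)
    have hle : e (n + k + 1) ≤ B' (S (S y (n + k + 1))) - B₁ (S (S y (n + k + 1))) :=
      hDmono2 _ _ (hS' _ hqm.1 hqm.2).1 (hS _ hqm.1 hqm.2).1 fun j => by rw [htail]; exact hcmp (n + k + 1) (by omega) j
    -- the combined relative size
    set ec : ℝ := ME₁ * S y (n + k + 1) / 2 + e (n + k + 1) with hec
    have hec0 : 0 ≤ ec := by have := he0 (n + k + 1); rw [hec]; positivity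
    have hecle : ec ≤ ME₁ * S y (n + k + 1) / 2 + (B' (S (S y (n + k + 1))) - B₁ (S (S y (n + k + 1)))) := by rw [hec]; linarith
    have hek : ec * ((k : ℝ) - 1) ≤ 1 / S y (n + k + 1) ^ 2 / 10 :=
      (mul_le_mul_of_nonneg_right hecle hk').trans (hElev (n + k + 1) k hk2 hkK (by omega))
    have hξ : ξ k = ec * S y (n + k + 1) ^ 2 := by simp only [hξ_def, hec]; ring
    rw [hξ]
    exact defect_level_le (B := B) (L := L) hL hβ hlo hh hf hec0 n (by omega) hek (hX (n + 1) le_rfl) hW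
  exact gauge_step_of_defect hBaff hL hβ hB' hM' hexc hDmono hS huniq hS' huniq' hy hyγ n hX hg hθ0 hdef hθle hprice

/-! ## §2 The nonlinear level gauge and the variation bound along every orbit -/

/-- **THE NONLINEAR LEVEL GAUGE FOR A SPLIT EXCESS UNDER THE RELATIVE-SIZE CONDITION.**  Base affine (any profile, range, size; `L_0 = 0`); `B ≤ B₁ ≤ B′`, `B₁ − B`
isotone of modulus `ME₁`, `B′ − B₁` isotone; `(ME₁·h_m∕2 + (B′−B₁)(S h_m))·(k−1) ≤ a_m∕10` for `2 ≤ k < K`, `m ≥ k+1` along `h = S y`; `B′` with modulus `M′`; unique solution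
families.  Then at EVERY depth `m`: `X_m ≥ 0`, `X_{m+1}h_{m+1}² ≤ X_mh_m²`, and `Σ_{j<J} h_{m+j}²·(e_{m+j} − e_{m+j+1}) ≤ X_mh_m²` for every `J` (row induction from the deep light
region, as (E124) `steps_nonneg_gauge_level` with `gauge_step_split_level`). [folklore] -/
theorem steps_nonneg_gauge_split_level (hBaff : ∀ u, SeqBox γ u → B u = β₀ + ∑ k ∈ range K, L k * u k) (hL : ∀ k, 0 ≤ L k) (hL0 : L 0 = 0) (hβ : 0 < β₀)
    (hB' : ∀ u u' : ℕ → ℝ, SeqBox γ u → SeqBox γ u' → ∀ D : ℝ, (∀ j, |u j - u' j| ≤ D) → |B' u - B' u'| ≤ M' * D) (hM' : 0 ≤ M')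
    (hexc1 : ∀ u, SeqBox γ u → B u ≤ B₁ u) (hexc2 : ∀ u, SeqBox γ u → B₁ u ≤ B' u)
    (hDmono1 : ∀ u v : ℕ → ℝ, SeqBox γ u → SeqBox γ v → (∀ j, u j ≤ v j) → B₁ u - B u ≤ B₁ v - B v)
    (hDmono2 : ∀ u v : ℕ → ℝ, SeqBox γ u → SeqBox γ v → (∀ j, u j ≤ v j) → B' u - B₁ u ≤ B' v - B₁ v)
    (hEmod1 : ∀ u u' : ℕ → ℝ, SeqBox γ u → SeqBox γ u' → (∀ j, u' j ≤ u j) → ∀ D : ℝ, 0 ≤ D → (∀ j, u j - u' j ≤ D) →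
      (B₁ u - B u) - (B₁ u' - B u') ≤ ME₁ * D) (hME1 : 0 ≤ ME₁)
    (hS : ∀ p, 0 < p → p ≤ γ → SeqBox γ (S p) ∧ MemFlow B p (S p))
    (huniq : ∀ p, 0 < p → p ≤ γ → ∀ u u' : ℕ → ℝ, SeqBox γ u → SeqBox γ u' → MemFlow B p u → MemFlow B p u' → u = u')
    (hS' : ∀ p, 0 < p → p ≤ γ → SeqBox γ (S' p) ∧ MemFlow B' p (S' p))
    (huniq' : ∀ p, 0 < p → p ≤ γ → ∀ u u' : ℕ → ℝ, SeqBox γ u → SeqBox γ u' → MemFlow B' p u → MemFlow B' p u' → u = u')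
    {y : ℝ} (hy : 0 < y) (hyγ : y ≤ γ)
    (hElev : ∀ m k, 2 ≤ k → k < K → k + 1 ≤ m →
      (ME₁ * S y m / 2 + (B' (S (S y m)) - B₁ (S (S y m)))) * ((k : ℝ) - 1) ≤ 1 / S y m ^ 2 / 10) :
    ∀ m, 0 ≤ B' (S' (S y m)) - B (S (S y m))
      ∧ (B' (S' (S y (m + 1))) - B (S (S y (m + 1)))) * S y (m + 1) ^ 2 ≤ (B' (S' (S y m)) - B (S (S y m))) * S y m ^ 2
      ∧ ∀ J, ∑ j ∈ range J, S y (m + j) ^ 2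
          * ((B' (S' (S y (m + j))) - B (S' (S y (m + j)))) - (B' (S' (S y (m + j + 1))) - B (S' (S y (m + j + 1)))))
        ≤ (B' (S' (S y m)) - B (S (S y m))) * S y m ^ 2 := by
  obtain ⟨hexc, hDmono⟩ := split_facts (γ := γ) hexc1 hexc2 hDmono1 hDmono2
  obtain ⟨hmono, hlo, hdom, hBmod⟩ := affine_facts hBaff hL hβ
  have hM : 0 ≤ ∑ k ∈ range K, L k := sum_nonneg fun k _ => hL k
  have hh := (hS y hy hyγ).1
  have hf := (hS y hy hyγ).2
  have hpos : ∀ j, 0 < S y j := fun j => (hh j).1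
  -- the deep region
  obtain ⟨N₀, hN₀⟩ := exists_base_depth_var hBaff hL hβ hh hf
  have hXdeep : ∀ m, N₀ ≤ m → 0 ≤ B' (S' (S y m)) - B (S (S y m)) := by
    intro m hm
    have hq := family_mem hS hy hyγ m
    have hsmall := (hN₀ m hm).1.2
    have := effective_le_of_small_pin hBmod hM hβ hlo hexc hDmono hq.1 hq.2 hsmall (hS _ hq.1 hq.2).1 (hS _ hq.1 hq.2).2
      (hS' _ hq.1 hq.2).1 (hS' _ hq.1 hq.2).2
    linarith
  -- P(n): non-negativity, the gauge and the variation bound at every m ≥ n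
  have hP : ∀ d n, N₀ ≤ n + d → ∀ m, n ≤ m → 0 ≤ B' (S' (S y m)) - B (S (S y m))
      ∧ (B' (S' (S y (m + 1))) - B (S (S y (m + 1)))) * S y (m + 1) ^ 2 ≤ (B' (S' (S y m)) - B (S (S y m))) * S y m ^ 2
      ∧ ∀ J, ∑ j ∈ range J, S y (m + j) ^ 2
          * ((B' (S' (S y (m + j))) - B (S' (S y (m + j)))) - (B' (S' (S y (m + j + 1))) - B (S' (S y (m + j + 1)))))
        ≤ (B' (S' (S y m)) - B (S (S y m))) * S y m ^ 2 := by
    intro d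
    induction d with
    | zero =>
      intro n hn m hm
      rw [add_zero] at hn
      have hcmp := cmp_of_steps_nonneg hBaff hL hβ hB' hM' hexc hDmono hS huniq hS' huniq' hy hyγ m fun m' hm' => hXdeep m' (by omega)
      refine ⟨hXdeep m (hn.trans hm), ?_, ?_⟩
      · exact base_gauge_light hBaff hL hL0 hβ hB' hM' hexc hDmono hS huniq hS' huniq' hy hyγ m (hN₀ m (hn.trans hm)).1.1 hcmp
          fun m' hm' => hXdeep m' (by omega)
      · exact var_base hBaff hL hβ hB' hM' hexc hDmono hS huniq hS' huniq' hy hyγ m (hN₀ m (hn.trans hm)).2 hcmp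
    | succ d ih =>
      intro n hn m hm
      have ih' := ih (n + 1) (by omega)
      by_cases hm1 : n + 1 ≤ m
      · exact ih' m hm1
      · have hmn : m = n := by omega
        subst hmn
        have hXb : ∀ m', m + 1 ≤ m' → 0 ≤ B' (S' (S y m')) - B (S (S y m')) := fun m' hm' => (ih' m' hm').1
        have hgb : ∀ m', m + 1 ≤ m' → (B' (S' (S y (m' + 1))) - B (S (S y (m' + 1)))) * S y (m' + 1) ^ 2
            ≤ (B' (S' (S y m')) - B (S (S y m'))) * S y m' ^ 2 := fun m' hm' => (ih' m' hm').2.1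
        have hVb : ∀ m', m + 2 ≤ m' → ∀ J, ∑ j ∈ range J, S y (m' + j) ^ 2
            * ((B' (S' (S y (m' + j))) - B (S' (S y (m' + j)))) - (B' (S' (S y (m' + j + 1))) - B (S' (S y (m' + j + 1)))))
            ≤ (B' (S' (S y m')) - B (S (S y m'))) * S y m' ^ 2 := fun m' hm' => (ih' m' (by omega)).2.2
        have hgs := gauge_step_split_level hBaff hL hL0 hβ hB' hM' hexc1 hexc2 hDmono1 hDmono2 hEmod1 hME1 hS huniq hS' huniq' hy hyγ hElev m hXb hgb hVb
        have hΔe := (excess_orbit_antitone hBaff hL hβ hB' hM' hexc hDmono hS hS' huniq' hy hyγ m).2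
        have hm2 : 0 < S y m ^ 2 := pow_pos (hpos m) 2
        have hΔe' : 0 ≤ ((B' (S' (S y m)) - B (S' (S y m))) - (B' (S' (S y (m + 1))) - B (S' (S y (m + 1))))) * S y m ^ 2 :=
          mul_nonneg (by linarith) hm2.le
        have hG1 : 0 ≤ (B' (S' (S y (m + 1))) - B (S (S y (m + 1)))) * S y (m + 1) ^ 2 := mul_nonneg (hXb (m + 1) le_rfl) (sq_nonneg _)
        refine ⟨?_, by linarith, ?_⟩
        · have h1 : 0 ≤ (B' (S' (S y m)) - B (S (S y m))) * S y m ^ 2 := by linarith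
          nlinarith
        · intro J
          cases J with
          | zero => simp only [range_zero, sum_empty]; linarith
          | succ J' =>
            rw [sum_range_succ']
            simp only [add_zero]
            have hrest := (ih' (m + 1) le_rfl).2.2 J'
            have e : ∑ j ∈ range J', S y (m + (j + 1)) ^ 2
                * ((B' (S' (S y (m + (j + 1)))) - B (S' (S y (m + (j + 1))))) - (B' (S' (S y (m + (j + 1) + 1))) - B (S' (S y (m + (j + 1) + 1)))))
                = ∑ j ∈ range J', S y (m + 1 + j) ^ 2
                * ((B' (S' (S y (m + 1 + j))) - B (S' (S y (m + 1 + j)))) - (B' (S' (S y (m + 1 + j + 1))) - B (S' (S y (m + 1 + j + 1))))) :=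
              sum_congr rfl fun j _ => by rw [show m + (j + 1) = m + 1 + j by ring]
            rw [e]
            linarith
  intro m
  exact hP N₀ 0 (by omega) m (Nat.zero_le m)

/-! ## §3 Comparison for a split excess small relative to the level -/

/-- **THE EFFECTIVE β-FUNCTIONS OF `B` AND `B′` ARE ORDERED AT EVERY ORBIT PIN**, `B(S h_i) ≤ B′(S′h_i)` for every `i`, `h = S p` — affine base of any profile and size,
split excess `E₁ + E₂` of any steepness and size under the relative-size condition along the orbit from `p` (the sub-orbit from `h_i` inherits it at depths `i+m`).
[folklore] -/
theorem effective_le_split_level (hBaff : ∀ u, SeqBox γ u → B u = β₀ + ∑ k ∈ range K, L k * u k) (hL : ∀ k, 0 ≤ L k) (hL0 : L 0 = 0) (hβ : 0 < β₀)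
    (hB' : ∀ u u' : ℕ → ℝ, SeqBox γ u → SeqBox γ u' → ∀ D : ℝ, (∀ j, |u j - u' j| ≤ D) → |B' u - B' u'| ≤ M' * D) (hM' : 0 ≤ M')
    (hexc1 : ∀ u, SeqBox γ u → B u ≤ B₁ u) (hexc2 : ∀ u, SeqBox γ u → B₁ u ≤ B' u)
    (hDmono1 : ∀ u v : ℕ → ℝ, SeqBox γ u → SeqBox γ v → (∀ j, u j ≤ v j) → B₁ u - B u ≤ B₁ v - B v)
    (hDmono2 : ∀ u v : ℕ → ℝ, SeqBox γ u → SeqBox γ v → (∀ j, u j ≤ v j) → B' u - B₁ u ≤ B' v - B₁ v)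
    (hEmod1 : ∀ u u' : ℕ → ℝ, SeqBox γ u → SeqBox γ u' → (∀ j, u' j ≤ u j) → ∀ D : ℝ, 0 ≤ D → (∀ j, u j - u' j ≤ D) →
      (B₁ u - B u) - (B₁ u' - B u') ≤ ME₁ * D) (hME1 : 0 ≤ ME₁)
    {p : ℝ} (hp : 0 < p) (hpγ : p ≤ γ)
    (hS : ∀ p, 0 < p → p ≤ γ → SeqBox γ (S p) ∧ MemFlow B p (S p))
    (huniq : ∀ p, 0 < p → p ≤ γ → ∀ u u' : ℕ → ℝ, SeqBox γ u → SeqBox γ u' → MemFlow B p u → MemFlow B p u' → u = u')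
    (hS' : ∀ p, 0 < p → p ≤ γ → SeqBox γ (S' p) ∧ MemFlow B' p (S' p))
    (huniq' : ∀ p, 0 < p → p ≤ γ → ∀ u u' : ℕ → ℝ, SeqBox γ u → SeqBox γ u' → MemFlow B' p u → MemFlow B' p u' → u = u')
    (hlev : ∀ m k, 2 ≤ k → k < K → k + 1 ≤ m →
      (ME₁ * S p m / 2 + (B' (S (S p m)) - B₁ (S (S p m)))) * ((k : ℝ) - 1) ≤ 1 / S p m ^ 2 / 10) :
    ∀ i, B (S (S p i)) ≤ B' (S' (S p i)) := by
  intro i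
  have hq := family_mem hS hp hpγ i
  have htail : ∀ m, S (S p i) m = S p (i + m) := fun m => (congrFun (family_tail_eq hS huniq hp hpγ i) m).symm
  have hElev : ∀ m k, 2 ≤ k → k < K → k + 1 ≤ m →
      (ME₁ * S (S p i) m / 2 + (B' (S (S (S p i) m)) - B₁ (S (S (S p i) m)))) * ((k : ℝ) - 1) ≤ 1 / S (S p i) m ^ 2 / 10 := by
    intro m k hk2 hkK hkm
    rw [htail m]
    exact hlev (i + m) k hk2 hkK (by omega)
  have := (steps_nonneg_gauge_split_level hBaff hL hL0 hβ hB' hM' hexc1 hexc2 hDmono1 hDmono2 hEmod1 hME1 hS huniq hS' huniq' hq.1 hq.2 hElev 0).1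
  rw [family_zero hS hq.1 hq.2] at this
  linarith

/-- **COMPARISON FOR EVERY SPLIT EXCESS SMALL RELATIVE TO THE LEVEL PER AGE, family-free form — the column's comparison classes in ONE statement.**  `B u = β₀ + Σ_{k<K}
L_k·u_k` on the box ]0,γ] with `β₀ > 0`, `L ≥ 0`, `L_0 = 0` — profile, range `K`, ALL SIZES AND LOADS ARBITRARY; functionals `B ≤ B₁ ≤ B′` on the box, `B₁ − B`
ISOTONE of modulus `ME₁` along ordered pairs (any size), `B′ − B₁` ISOTONE (any steepness, any size); `B′` with a modulus `M′ ≥ 0`; `h`, `h′` ANY box solutions of `B`,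
`B′` from one pin `p ∈ ]0,γ]`; and along the BASE solution `h`: **`(ME₁·h_m∕2 + (B′ − B₁)(h_m, h_{m+1}, …))·(k−1) ≤ (1∕h_m²)∕10` for `2 ≤ k < K`, `m ≥ k+1`.**  Then
`h′ ≤ h` at EVERY scale.  INSTANCES (`1∕h_m² ≥ 1∕p² + m·β₀`, `h_m ≤ γ`): (E119d) `le_of_small_modulus_excess` (`B′ = B₁`, `ME·γ ≤ β₀∕5`); (E121e) `le_of_small_isotone_excess`
(`B₁ = B`, `E ≤ β₀∕10`); (E121f) `le_of_isotone_excess_sizepin` ∕ `_uv`; (E123b) `le_of_split_excess` (`5ME₁γ + 10E₂ ≤ β₀`); (E124) `le_of_isotone_excess_level` (`B₁ = B`).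
[folklore] -/
theorem le_of_split_excess_level {p : ℝ} {h h' : ℕ → ℝ} (hBaff : ∀ u, SeqBox γ u → B u = β₀ + ∑ k ∈ range K, L k * u k) (hL : ∀ k, 0 ≤ L k)
    (hL0 : L 0 = 0) (hβ : 0 < β₀)
    (hB' : ∀ u u' : ℕ → ℝ, SeqBox γ u → SeqBox γ u' → ∀ D : ℝ, (∀ j, |u j - u' j| ≤ D) → |B' u - B' u'| ≤ M' * D) (hM' : 0 ≤ M')
    (hexc1 : ∀ u, SeqBox γ u → B u ≤ B₁ u) (hexc2 : ∀ u, SeqBox γ u → B₁ u ≤ B' u)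
    (hDmono1 : ∀ u v : ℕ → ℝ, SeqBox γ u → SeqBox γ v → (∀ j, u j ≤ v j) → B₁ u - B u ≤ B₁ v - B v)
    (hDmono2 : ∀ u v : ℕ → ℝ, SeqBox γ u → SeqBox γ v → (∀ j, u j ≤ v j) → B' u - B₁ u ≤ B' v - B₁ v)
    (hEmod1 : ∀ u u' : ℕ → ℝ, SeqBox γ u → SeqBox γ u' → (∀ j, u' j ≤ u j) → ∀ D : ℝ, 0 ≤ D → (∀ j, u j - u' j ≤ D) →
      (B₁ u - B u) - (B₁ u' - B u') ≤ ME₁ * D) (hME1 : 0 ≤ ME₁)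
    (hp : 0 < p) (hpγ : p ≤ γ) (hh : SeqBox γ h) (hf : MemFlow B p h) (hh' : SeqBox γ h') (hf' : MemFlow B' p h')
    (hlev : ∀ m k, 2 ≤ k → k < K → k + 1 ≤ m →
      (ME₁ * h m / 2 + (B' (fun j => h (m + j)) - B₁ (fun j => h (m + j)))) * ((k : ℝ) - 1) ≤ 1 / h m ^ 2 / 10) (j : ℕ) :
    h' j ≤ h j := by
  obtain ⟨hexc, hDmono⟩ := split_facts (γ := γ) hexc1 hexc2 hDmono1 hDmono2
  obtain ⟨hmono', hlo'⟩ := excess_facts hBaff hL hβ hexc hDmono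
  obtain ⟨hmono, hlo, _, hBmod⟩ := affine_facts hBaff hL hβ
  have hM : 0 ≤ ∑ k ∈ range K, L k := sum_nonneg fun k _ => hL k
  have hγ : 0 < γ := hp.trans_le hpγ
  have hex : ∀ q : ℝ, 0 < q → q ≤ γ → ∃ k : ℕ → ℝ, SeqBox γ k ∧ MemFlow B q k := fun q hq hqγ => exists_memFlow_zm hBmod hM hq hqγ hβ hlo
  have hex' : ∀ q : ℝ, 0 < q → q ≤ γ → ∃ k : ℕ → ℝ, SeqBox γ k ∧ MemFlow B' q k := fun q hq hqγ => exists_memFlow_zm hB' hM' hq hqγ hβ hlo'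
  choose! S hSb hSf using hex
  choose! S' hS'b hS'f using hex'
  have hS : ∀ q, 0 < q → q ≤ γ → SeqBox γ (S q) ∧ MemFlow B q (S q) := fun q hq hqγ => ⟨hSb q hq hqγ, hSf q hq hqγ⟩
  have hS' : ∀ q, 0 < q → q ≤ γ → SeqBox γ (S' q) ∧ MemFlow B' q (S' q) := fun q hq hqγ => ⟨hS'b q hq hqγ, hS'f q hq hqγ⟩
  have huniq : ∀ q, 0 < q → q ≤ γ → ∀ u u' : ℕ → ℝ, SeqBox γ u → SeqBox γ u' → MemFlow B q u → MemFlow B q u' → u = u' :=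
    fun q hq _ u u' hu hu' hfu hfu' => memFlow_unique_of_monotone_zm hmono hBmod hM hq hβ hlo hu hu' hfu hfu'
  have huniq' : ∀ q, 0 < q → q ≤ γ → ∀ u u' : ℕ → ℝ, SeqBox γ u → SeqBox γ u' → MemFlow B' q u → MemFlow B' q u' → u = u' :=
    fun q hq _ u u' hu hu' hfu hfu' => memFlow_unique_of_monotone_zm hmono' hB' hM' hq hβ hlo' hu hu' hfu hfu'
  have e : h = S p := huniq p hp hpγ _ _ hh (hS p hp hpγ).1 hf (hS p hp hpγ).2
  have e' : h' = S' p := huniq' p hp hpγ _ _ hh' (hS' p hp hpγ).1 hf' (hS' p hp hpγ).2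
  have hlevS : ∀ m k, 2 ≤ k → k < K → k + 1 ≤ m →
      (ME₁ * S p m / 2 + (B' (S (S p m)) - B₁ (S (S p m)))) * ((k : ℝ) - 1) ≤ 1 / S p m ^ 2 / 10 := by
    intro m k hk2 hkK hkm
    have ht : (fun j => S p (m + j)) = S (S p m) := family_tail_eq hS huniq hp hpγ m
    have := hlev m k hk2 hkK hkm
    rwa [e, ht] at this
  rw [e, e']
  exact family_le_of_orbit hβ hγ hB' hM' hlo' hS huniq hS' huniq' ⟨hp, hpγ⟩ (fun i _ =>
    effective_le_split_level hBaff hL hL0 hβ hB' hM' hexc1 hexc2 hDmono1 hDmono2 hEmod1 hME1 hp hpγ hS huniq hS' huniq' hlevS i) j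

end Summit.QuantumFields.BalabanUV.Beta.EriceRemainderEnclosureHistoryAutonomyComparisonNonlinearSplitLevel

end
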